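import Mathlib
import HarnessLib
import Summits.QuantumFields.YangMills.Theorems.ComplexCouplingChannelContinuumLegGivenGapAlternatingArraysDefs
import Summits.QuantumFields.YangMills.Theorems.ComplexCouplingChannelContinuumLegGivenGapProductToUniformDefs
import Summits.QuantumFields.YangMills.Theorems.ComplexCouplingChannelContinuumLegGivenGapPtuGeometryBasics
import Summits.QuantumFields.YangMills.Theorems.ComplexCouplingChannelContinuumLegGivenGapPtuGeometryCoverage
import Summits.QuantumFields.YangMills.Theorems.ComplexCouplingChannelContinuumLegGivenGapPtuGeometryCounting

/-!
# Stub `stub_ptuGeometry` of crux `ContinuumLegGivenGap` (stmt-QuantumFields-15828), line `alternating-curvature-arrays`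

Piece 1 of the sub-skeleton of `stub_productToUniform` ((PB) ⇒ (UUVB)): the GEOMETRY of the Whitney system of
`Theorems/ComplexCouplingChannelContinuumLegGivenGapProductToUniformDefs.lean` — coverage `W ≥ 1`, weights in `[0, 1]`,
the near / outer support criteria, the index-set facts (admissible level, `m₀ ≤ m`, `d ≥ 32`, half-box cells,
injective assignments, inner cut-offs supported in the cores, outer cut-off `= 1` on the inner support, closeness
`≤ 240 ℓ` and cell boxes on `supp φ̃`) and the counting bound over the index set.  Assembled from the landed helpers
G1 `…PtuGeometryBasics.lean` (`ptuGeom_index_facts`, values, criteria), G2 `…PtuGeometryCoverage.lean`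
(`ptuGeom_coverage`) and G3 `…PtuGeometryCounting.lean` (`ptuGeom_counting`, which supplies the constant `c`).
[folklore]
-/

set_option autoImplicit false

noncomputable section

open scoped Classical

namespace Summit.QuantumFields.YangMills.Theorems.ContinuumLegGivenGap

open scoped BigOperators
open Summit.QuantumFields.YangMills.Theorems.ContinuumLegGivenGap.AlternatingArrays

/-- **Piece 1 — geometry of the Whitney system** (coverage `W ≥ 1`; values in `[0,1]`; near / outer support criteria;
index-set facts: admissible level, `m₀ ≤ m`, `d ≥ 32`, half-box cells, injective assignments, inner cut-offs supported in
the cores, outer cut-off `= 1` on the support of the inner one, closeness `≤ 240 ℓ` and cell boxes on `supp φ̃`; and the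
counting bound over the index set with decay weights).  Proof: the constant is the one of `ptuGeom_counting`; coverage is
`ptuGeom_coverage`; the values / criteria / index-set facts are the lemmas of `…PtuGeometryBasics`. [folklore] -/
theorem stub_ptuGeometry :
    ∃ c : ℝ, 0 < c ∧ ∀ (a : ℝ) (L p : ℕ), 0 < a → IsTriadic L → 1 ≤ L → 2 ≤ p →
      (∀ y : (Fin p → EuclideanSpace ℝ (Fin 4)), 1 ≤ ptuW a L p y) ∧
      (∀ y : (Fin p → EuclideanSpace ℝ (Fin 4)), 0 ≤ ptuNear a p y ∧ ptuNear a p y ≤ 1) ∧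
      (∀ y : (Fin p → EuclideanSpace ℝ (Fin 4)), 0 ≤ ptuOut a L p y ∧ ptuOut a L p y ≤ 1) ∧
      (∀ (m : ℕ) (v : Fin 4 → ℤ) (z : Fin p → Fin 4 → ℤ) (y : (Fin p → EuclideanSpace ℝ (Fin 4))),
        0 ≤ ptuPhiStar a m p v z y ∧ ptuPhiStar a m p v z y ≤ 1) ∧
      (∀ y : (Fin p → EuclideanSpace ℝ (Fin 4)), ptuNear a p y ≠ 0 →
        ∃ i j : Fin p, i ≠ j ∧ ∀ μ : Fin 4, |y i μ - y j μ| < (ptuR p : ℝ) * a) ∧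
      (∀ y : (Fin p → EuclideanSpace ℝ (Fin 4)), ptuOut a L p y ≠ 0 → ∃ (i : Fin p) (μ : Fin 4), a * (L : ℝ) / 8 < |y i μ|) ∧
      (∀ m ∈ ptuLevels L p, LevelAdmissible L m ∧ ptuM0 p ≤ m ∧ 32 ≤ ptuD m p ∧
        ∀ vz ∈ ptuIdx L m p,
          (∀ i : Fin p, CellInHalfBox L m vz.1 (vz.2 i)) ∧ Function.Injective vz.2 ∧
          (∀ i : Fin p, tsupport (ptuChiFun a m p vz.1 (vz.2 i)) ⊆ physCore a m vz.1 (vz.2 i)) ∧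
          (∀ (i : Fin p) (u : EuclideanSpace ℝ (Fin 4)), u ∈ tsupport (ptuChiFun a m p vz.1 (vz.2 i)) →
            ptuChiTildeFun a m p vz.1 (vz.2 i) u = 1) ∧
          (∀ y : (Fin p → EuclideanSpace ℝ (Fin 4)), y ∈ tsupport (ptuPhiTilde a m p vz.1 vz.2) →
            (∃ i j : Fin p, i ≠ j ∧ ‖y i - y j‖ ≤ 240 * (a * cellSide m)) ∧
            ∀ (i : Fin p) (μ : Fin 4), a * ((vz.1 μ : ℝ) + cellSide m * (vz.2 i μ : ℝ)) ≤ y i μ ∧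
              y i μ ≤ a * ((vz.1 μ : ℝ) + cellSide m * ((vz.2 i μ : ℝ) + 1)))) ∧
      (∀ m ∈ ptuLevels L p, ∀ g : (Fin 4 → ℤ) × (Fin p → Fin 4 → ℤ) → (Fin p → EuclideanSpace ℝ (Fin 4)),
        (∀ vz ∈ ptuIdx L m p, ∀ (i : Fin p) (μ : Fin 4),
          a * ((vz.1 μ : ℝ) + cellSide m * (vz.2 i μ : ℝ)) ≤ g vz i μ ∧
            g vz i μ ≤ a * ((vz.1 μ : ℝ) + cellSide m * ((vz.2 i μ : ℝ) + 1))) →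
        ∑ vz ∈ ptuIdx L m p, (((1 + ‖g vz‖) ^ 6)⁻¹) ^ p ≤
          (2 * (p : ℝ) + 1) ^ 4 * (c * max 1 ((a * cellSide m)⁻¹ ^ 4)) ^ p) := by
  obtain ⟨c, hc, hcount⟩ := ptuGeom_counting
  refine ⟨c, hc, fun a L p ha hL hL1 hp => ⟨ptuGeom_coverage a L p ha hL hL1 hp, fun y => ptuNear_mem a p y,
    fun y => ptuOut_mem a L p y, fun m v z y => ptuPhiStar_mem a m p v z y, fun y hy => ptuNear_ne_zero_imp ha hy,
    fun y hy => ptuOut_ne_zero_imp ha hL1 hy, ptuGeom_index_facts a L p ha hL, hcount a L p ha⟩⟩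

end Summit.QuantumFields.YangMills.Theorems.ContinuumLegGivenGap

end
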